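import Literature.NumberTheory.Automorphic.GLOneOfHeckeCharacterBJ
import Literature.NumberTheory.Automorphic.PairLFunctionPolesRankNeTwist
import HarnessLib

/-!
# Twisting automorphic representations of `GL_n(𝔸_K)` by an arbitrary Hecke character in the
# Borel–Jacquet model: `π ⊗ (χ ∘ det)` and `t_{π ⊗ χ, v} = χ(ϖ_v) t_{π, v}`

Topic `NumberTheory/Automorphic`; a proof file (theorems only: no definition, no named fact, no
instance). The tree constructs the twist `π ⊗ (χ ∘ det)` of a Borel–Jacquet datum `π = W / W'`
(`AutomorphicRepData (AutomorphyDatum.gl n K hcpt)`, Borel–Jacquet 1979, §4.6) for Hecke characters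
`χ` **of finite order** (`AutomorphicTwistBJ`: `χ ∘ det` is trivial on `exp 𝔤`) and for the **norm
powers** `χ = ‖·‖^s` (`AutomorphicTwistNorm`, with the archimedean calculus of
`ArchimedeanCharacterTwist` for differentials `s λ`, `λ` real). Here `χ` is an **arbitrary idèle
class character** (`HeckeCharacter K`: continuous, trivial on `Kˣ`, no unitarity) — the generality
needed to twist by a central character `ω_π` (e.g. `Sym²(π) = Ad(π) ⊗ ω_π`,
`GelbartJacquetSymmSquareProofs`). Everything is proved; the twisted datum is packaged existentially.

* **Archimedean calculus for an arbitrary differential.** `zOrbitSpan_mulChar_le_of_exp_smul`,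
  `isZFinite_mulChar_of_exp_smul` — the single-character form of
  `ArchimedeanCharacterTwist.isZFinite_mulChar_of_exp_family` (differential `s λ`, `λ` real killing
  brackets, `s ∈ ℂ`; the family is only ever used at its own parameter); `exists_monoidHom_coe_eq_norm`
  (`|c|` is a character) and **`isZFinite_mulChar_of_exp`**: if `c (ι (exp X)) = e^{δ(X)}` for *any*
  `ℝ`-linear `δ : 𝔤 → ℂ` killing brackets, `c · φ` is `Z(𝔤)`-finite for `φ` smooth and
  `Z(𝔤)`-finite — by the polar factorisation `c = |c| · (c/|c|)`, whose factors have the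
  differentials `re δ` (real: `isZFinite_mulChar_of_exp_real`) and `i · im δ` (a complex multiple of
  a real form).
* **The differential of `χ ∘ det` on `GL_n`.** `det_ofInfinite_expGL_add`
  (`det (exp (X + Y), 1) = det (exp X, 1) det (exp Y, 1)` in `𝕀_K`, from `det ∘ exp = exp ∘ tr`,
  `Literature.Analysis.Matrix.det_exp_eq_exp_trace`), and
  **`exists_linearMap_detTwist_ofArch_expMem_hecke`**: `χ (det (exp X, 1)) = e^{δ(X)}` for a real-linear
  `δ : 𝔤𝔩_n(K_∞) → ℂ` vanishing on brackets (`exists_linearMap_exp_eq` of `GLOneOfHeckeCharacterBJ`;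
  Tate (1950), §2.3).
* **`IsAutomorphicForm.mulChar_detTwist_hecke`** — `(χ ∘ det) · φ` is an automorphic form if `φ` is
  (`n ≥ 1`; Borel–Jacquet 1979, §4.2 (a)–(d)): level `U ∩ K(𝔪)` (`HeckeCharacter.exists_level`,
  `inf_mem_finiteLevelsGL`), smoothness and `Z(𝔤)`-finiteness from the differential,
  `K_∞`-finiteness, moderate growth from `|χ| = ‖·‖^σ`
  (`HeckeCharacter.exists_norm_apply_eq_ideleNorm_rpow`) and `|det g|_𝔸^σ ≤ C (1 ⊔ ‖g‖)^r`.
* `IsStableSubmodule.map_mulChar_detTwist_hecke`, **`exists_automorphicRepData_twist_hecke`**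
  (the datum `W · (χ∘det) / W' · (χ∘det)`), `IsCuspFormGL.mulChar_detTwist_hecke`,
  **`exists_cuspidalAutomorphicRepData_twist_hecke`** (Borel–Jacquet 1979, 4.4–4.6, 5.7;
  Jacquet–Langlands 1970, §11; Arthur–Clozel 1989, Ch. 3 §1).
* **Satake parameters** (Arthur–Clozel 1989, Ch. 3, proof of Thm. 3.1, p. 172:
  `t_{π ⊗ η, v} = η(ϖ_v) t_{π, v}`): `AutomorphicRepData.HasSatakeParamAt.map_mulChar_detTwist_hecke`
  (at level `K(𝔫𝔪)`, verbatim the computation of `HasSatakeParamAt.twist`, which uses no finiteness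
  of the order of `χ`), `…_of_isUnramifiedAt`, the almost-everywhere form
  `AutomorphicRepData.eventually_hasSatakeParamAt_of_map_mulChar_detTwist`, and the one-line summary
  **`CuspidalAutomorphicRepData.exists_twist_hecke_hasSatakeParamAt`**: for every `χ` and cuspidal
  `π` on `GL_n(𝔸_K)` there is a cuspidal `π'` with `t_{π',v} = χ(ϖ_v) t_{π,v}` for almost all `v`.

## References

* A. Borel, H. Jacquet, *Automorphic forms and automorphic representations*, Proc. Sympos. Pure
  Math. 33 (Corvallis 1979), part 1, §4.2–4.6, 5.7. [BorelJacquet1979]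
* H. Jacquet, R. P. Langlands, *Automorphic Forms on GL(2)*, LNM 114 (1970), §11.
  [JacquetLanglands1970]
* J. Arthur, L. Clozel, *Simple algebras, base change, and the advanced theory of the trace
  formula*, Ann. of Math. Stud. 120 (1989), Ch. 3, §1 and proof of Thm. 3.1 (p. 172).
  [ArthurClozelAMS120]
* J. Tate, *Fourier analysis in number fields and Hecke's zeta-functions* (1950), §2.3 and Lemma
  3.2.1, in Cassels–Fröhlich (1967), Ch. XV. [TateThesis1967]
-/

noncomputable section

open scoped MatrixGroups Matrix ContDiff NumberField
open Polynomial NumberField NumberField.mixedEmbedding IsDedekindDomain NormedSpace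

namespace Literature.NumberTheory.Automorphic

/-! ### `Z(𝔤)`-finiteness under a character with differential `s λ` (one character, no family) -/

section SmulReal

variable {A : Type*} [NormedCommRing A] [NormedAlgebra ℝ A] [NormedAlgebra ℚ A] [CompleteSpace A]
  [StarRing A] {N : Type*} [Fintype N] [DecidableEq N] {H : RealMatrixGroup A N}
  {G : Type*} [Group G] (ι : H.carrier →* G) {c : G →* ℂˣ} {lam : H.lie →ₗ[ℝ] ℝ}

/-- **The `Z(𝔤)`-orbit span of `c · φ` lies in `c ·` (that of `φ`) for a character `c` with
`c (ι (exp X)) = e^{s λ(X)}`** (`λ : 𝔤 → ℝ` linear, vanishing on brackets, `s ∈ ℂ`). This is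
`zOrbitSpan_mulChar_le_of_exp_family` of `ArchimedeanCharacterTwist` for a single character instead
of a family `(c_s)_{s ∈ ℂ}` (the family is used there only at the parameter `s`): for a central
word `p`, `p (c · φ) = c · P(s) φ` with `P` an operator-valued polynomial whose values at real
parameters are `p_r φ` for central words `p_r`, hence lie in the `Z(𝔤)`-orbit span of `φ`; so do
its coefficients (Vandermonde) and its value at `s`. Borel–Jacquet 1979, §4.2 (c) and 5.7. [cite: BorelJacquet1979, §4.2] -/
theorem zOrbitSpan_mulChar_le_of_exp_smul [FiniteDimensional ℝ A]
    (hlam : ∀ X Y : H.lie, lam ⁅X, Y⁆ = 0) (s : ℂ)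
    (hc : ∀ X : H.lie, (c (ι (H.expMem X)) : ℂ) = Complex.exp (s * (lam X : ℂ)))
    {φ : G → ℂ} (hφ : IsArchSmooth ι φ) :
    zOrbitSpan ι (mulChar c φ) ≤ (zOrbitSpan ι φ).map (mulChar c) := by
  -- Mathlib idiom (Mathlib/Algebra/Lie/OfAssociative.lean): the commutator Lie structure on `End`
  letI : LieRing (Module.End ℂ (archSmooth ι)) := LieRing.ofAssociativeRing
  rw [zOrbitSpan, Submodule.span_le]
  rintro _ ⟨p, hp, rfl⟩
  obtain ⟨ρ, hρ⟩ := exists_lieHom_lieDeriv ι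
  -- the family of twisted actions `ρ_z (X) = ρ X + z λ(X)`
  have hex : ∀ z : ℂ, ∃ ρ' : H.lie →ₗ⁅ℝ⁆ Module.End ℂ (archSmooth ι),
      ∀ X, ρ' X = ρ X + (z * (lam X : ℂ)) • (1 : Module.End ℂ (archSmooth ι)) := fun z => by
    obtain ⟨ρ', h⟩ := exists_lieHom_add_smul_one ρ (z • (Complex.ofRealAm.toLinearMap.comp lam))
      (fun X Y => by
        rw [LinearMap.smul_apply, LinearMap.comp_apply, hlam]
        simp)
    exact ⟨ρ', fun X => by rw [h]; rfl⟩
  choose ρs hρs using hex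
  -- `p (c φ) = c • (ρ_s-action of p on φ)`
  have hcs : ∀ X : H.lie, (c (ι (H.expMem X)) : ℂ) =
      Complex.exp ((s • (Complex.ofRealAm.toLinearMap.comp lam)) X) := fun X => by
    rw [hc]; rfl
  rw [SetLike.mem_coe, applyFree_mulChar_eq_envelopingAction ι hcs hρ (ρ' := ρs s)
    (fun X => by rw [hρs]; rfl) p hφ]
  refine Submodule.mem_map_of_mem ?_
  -- polynomial dependence on the parameter
  obtain ⟨P, hP⟩ := exists_polynomial_envelopingAction_eq ρ lam ρs hρs (freeToEnveloping H p)
  have hexp : ∀ z : ℂ, ((envelopingAction (ρs z) (freeToEnveloping H p) ⟨φ, hφ⟩ : archSmooth ι) :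
      G → ℂ) = ∑ k ∈ Finset.range (P.natDegree + 1),
        z ^ k • ((P.coeff k ⟨φ, hφ⟩ : archSmooth ι) : G → ℂ) := by
    intro z
    rw [hP z, Polynomial.eval₂_eq_sum_range, LinearMap.sum_apply, Submodule.coe_sum]
    refine Finset.sum_congr rfl fun k _ => ?_
    rw [RingHom.id_apply, ← map_pow, Module.End.mul_apply, Module.algebraMap_end_apply, map_smul,
      Submodule.coe_smul]
  -- at real parameters the value lies in the `Z(𝔤)`-orbit span of `φ`
  have hreal : ∀ r : ℝ, ∑ k ∈ Finset.range (P.natDegree + 1),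
      ((r : ℂ) ^ k) • ((P.coeff k ⟨φ, hφ⟩ : archSmooth ι) : G → ℂ) ∈ zOrbitSpan ι φ := by
    intro r
    rw [← hexp (r : ℂ)]
    have hρr : ∀ X, ρs (r : ℂ) X = ρ X + (((r • lam) X : ℝ) : ℂ) • (1 : Module.End ℂ (archSmooth ι)) :=
      fun X => by rw [hρs, LinearMap.smul_apply, smul_eq_mul, Complex.ofReal_mul]
    rw [envelopingAction_freeToEnveloping_eq_of_add (ρ := ρ) hρr p,
      coe_envelopingAction_freeToEnveloping_of_forall_eq ρ hρ]
    refine Submodule.subset_span ⟨_, isCentralWord_lift_add_algebraMap H (lam := r • lam)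
      (fun X Y => by rw [LinearMap.smul_apply, hlam, smul_zero]) hp, rfl⟩
  -- Vandermonde: the coefficients, hence the value at `s`, lie in the orbit span
  have hcoeff := mem_of_forall_sum_ofReal_pow_smul_mem (zOrbitSpan ι φ)
    (fun k => ((P.coeff k ⟨φ, hφ⟩ : archSmooth ι) : G → ℂ)) P.natDegree hreal
  rw [hexp s]
  exact Submodule.sum_mem _ fun k hk => Submodule.smul_mem _ _ (hcoeff k hk)

/-- **`Z(𝔤)`-finiteness is preserved by twisting with a character with differential `s λ`**
(`λ` real, vanishing on brackets, `s ∈ ℂ`), for `φ` smooth in the archimedean variable.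
Borel–Jacquet 1979, §4.2 (c). [cite: BorelJacquet1979, §4.2] -/
theorem isZFinite_mulChar_of_exp_smul [FiniteDimensional ℝ A]
    (hlam : ∀ X Y : H.lie, lam ⁅X, Y⁆ = 0) (s : ℂ)
    (hc : ∀ X : H.lie, (c (ι (H.expMem X)) : ℂ) = Complex.exp (s * (lam X : ℂ)))
    {φ : G → ℂ} (hφ : IsArchSmooth ι φ) (hZ : IsZFinite ι φ) : IsZFinite ι (mulChar c φ) := by
  unfold IsZFinite at hZ ⊢
  exact Submodule.finiteDimensional_of_le (zOrbitSpan_mulChar_le_of_exp_smul ι hlam s hc hφ)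

end SmulReal

/-! ### Arbitrary differentials: polar factorisation `c = |c| · (c / |c|)` -/

section General

variable {A : Type*} [NormedCommRing A] [NormedAlgebra ℝ A] [NormedAlgebra ℚ A] [CompleteSpace A]
  [StarRing A] {N : Type*} [Fintype N] [DecidableEq N] {H : RealMatrixGroup A N}
  {G : Type*} [Group G] (ι : H.carrier →* G) {c : G →* ℂˣ} {δ : H.lie →ₗ[ℝ] ℂ}

omit [NormedAlgebra ℝ A] [NormedAlgebra ℚ A] [CompleteSpace A] [StarRing A] [Fintype N]
  [DecidableEq N] in
/-- **The absolute value of a character is a character**: for `c : G → ℂˣ` there is a character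
`|c| : G → ℂˣ` with values `‖c g‖ ∈ ℝ_{>0} ⊂ ℂˣ` (polar decomposition of quasi-characters,
Tate (1950), §2.3). [folklore] -/
theorem exists_monoidHom_coe_eq_norm (c : G →* ℂˣ) :
    ∃ c₁ : G →* ℂˣ, ∀ g, (c₁ g : ℂ) = (‖(c g : ℂ)‖ : ℂ) := by
  have hne : ∀ g, ((‖(c g : ℂ)‖ : ℝ) : ℂ) ≠ 0 := fun g =>
    Complex.ofReal_ne_zero.2 (norm_ne_zero_iff.2 (Units.ne_zero _))
  refine ⟨{ toFun := fun g => Units.mk0 _ (hne g)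
            map_one' := Units.ext (by simp)
            map_mul' := fun g h => Units.ext ?_ }, fun g => rfl⟩
  simp only [map_mul, Units.val_mul, norm_mul, Complex.ofReal_mul, Units.val_mk0]

/-- **`Z(𝔤)`-finiteness is preserved by twisting with any character with a differential.** If
`c (ι (exp X)) = e^{δ(X)}` for an `ℝ`-linear `δ : 𝔤 → ℂ` vanishing on brackets, and `φ` is smooth
in the archimedean variable and `Z(𝔤)`-finite, then `c · φ` is `Z(𝔤)`-finite. Proof: factor
`c = |c| · (c/|c|)`; `|c|` has the *real* differential `re δ` (`isZFinite_mulChar_of_exp_real`) and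
`c/|c|` the differential `i · im δ`, a complex multiple of a real form (`isZFinite_mulChar_of_exp_smul`).
This is condition (c) of Borel–Jacquet 1979, §4.2 for the twist `π ⊗ (χ ∘ det)` by an arbitrary
idèle class character `χ` (op. cit. 5.7; Jacquet–Langlands 1970, §11). [cite: BorelJacquet1979, §4.2] -/
theorem isZFinite_mulChar_of_exp [FiniteDimensional ℝ A]
    (hδ : ∀ X Y : H.lie, δ ⁅X, Y⁆ = 0)
    (hc : ∀ X : H.lie, (c (ι (H.expMem X)) : ℂ) = Complex.exp (δ X))
    {φ : G → ℂ} (hφ : IsArchSmooth ι φ) (hZ : IsZFinite ι φ) : IsZFinite ι (mulChar c φ) := by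
  obtain ⟨c₁, hc₁⟩ := exists_monoidHom_coe_eq_norm c
  -- the real and imaginary parts of `δ`
  set lam₁ : H.lie →ₗ[ℝ] ℝ := Complex.reLm.comp δ with hlam₁
  set lam₂ : H.lie →ₗ[ℝ] ℝ := Complex.imLm.comp δ with hlam₂
  have hlam₁br : ∀ X Y : H.lie, lam₁ ⁅X, Y⁆ = 0 := fun X Y => by
    rw [hlam₁, LinearMap.comp_apply, hδ, map_zero]
  have hlam₂br : ∀ X Y : H.lie, lam₂ ⁅X, Y⁆ = 0 := fun X Y => by
    rw [hlam₂, LinearMap.comp_apply, hδ, map_zero]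
  -- `|c| (ι (exp X)) = e^{re δ(X)}`
  have hc₁exp : ∀ X : H.lie, (c₁ (ι (H.expMem X)) : ℂ) = Complex.exp ((lam₁ X : ℝ) : ℂ) := fun X => by
    rw [hc₁, hc, Complex.norm_exp, Complex.ofReal_exp]
    rfl
  -- `(c / |c|) (ι (exp X)) = e^{i im δ(X)}`
  have hc₂exp : ∀ X : H.lie, ((c * c₁⁻¹) (ι (H.expMem X)) : ℂ) =
      Complex.exp (Complex.I * (lam₂ X : ℂ)) := fun X => by
    rw [MonoidHom.mul_apply, MonoidHom.inv_apply, Units.val_mul, Units.val_inv_eq_inv_val, hc₁, hc,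
      Complex.norm_exp, Complex.ofReal_exp, ← Complex.exp_neg, ← Complex.exp_add]
    congr 1
    change δ X + -((δ X).re : ℂ) = Complex.I * ((δ X).im : ℂ)
    linear_combination (-1 : ℂ) * Complex.re_add_im (δ X)
  have h1 : IsZFinite ι (mulChar c₁ φ) := isZFinite_mulChar_of_exp_real ι hlam₁br hc₁exp hφ hZ
  have h1s : IsArchSmooth ι (mulChar c₁ φ) :=
    isArchSmooth_mulChar_of_exp ι (δ := Complex.ofRealAm.toLinearMap.comp lam₁)
      (fun X => by rw [hc₁exp]; rfl) hφ
  have h2 : IsZFinite ι (mulChar (c * c₁⁻¹) (mulChar c₁ φ)) :=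
    isZFinite_mulChar_of_exp_smul ι hlam₂br Complex.I hc₂exp h1s h1
  have hcc : c * c₁⁻¹ * c₁ = c := inv_mul_cancel_right c c₁
  rw [mulChar_mulChar, hcc] at h2
  exact h2

end General

/-! ### The differential of `χ ∘ det` along `𝔤𝔩_n(K_∞)` for an arbitrary Hecke character `χ` -/

section DetTwistHecke

open scoped Classical
open Literature.NumberTheory.GaloisRepresentations (HeckeCharacter ideleGroup localUnits)

variable {n : ℕ} {K : Type} [Field K] [NumberField K]

/-- `det (g, 1) ∈ 𝕀_K` depends only on `det g ∈ K_∞ˣ` (its components are `(det g, 1)`,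
`coe_det_ofInfinite_fst`, `coe_det_ofInfinite_snd`). [folklore] -/
theorem det_ofInfinite_eq_of_det_eq {g g' : GL (Fin n) (mixedSpace K)}
    (h : (g : Matrix (Fin n) (Fin n) (mixedSpace K)).det = (g' : Matrix (Fin n) (Fin n) (mixedSpace K)).det) :
    Matrix.GeneralLinearGroup.det (GLn.ofInfinite n K g) =
      Matrix.GeneralLinearGroup.det (GLn.ofInfinite n K g') := by
  refine Units.ext (Prod.ext ?_ ?_)
  · rw [coe_det_ofInfinite_fst, coe_det_ofInfinite_fst, h]
  · rw [coe_det_ofInfinite_snd, coe_det_ofInfinite_snd]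

/-- **`det (exp (X + Y), 1) = det (exp X, 1) · det (exp Y, 1)`** in `𝕀_K`, for
`X, Y ∈ 𝔤𝔩_n(K_∞)`: `det (exp X) = exp (tr X)` (`Literature.Analysis.Matrix.det_exp_eq_exp_trace`)
and `exp` is a homomorphism on the commutative algebra `K_∞`. [folklore] -/
theorem det_ofInfinite_expGL_add (X Y : Matrix (Fin n) (Fin n) (mixedSpace K)) :
    Matrix.GeneralLinearGroup.det (GLn.ofInfinite n K (expGL (X + Y))) =
      Matrix.GeneralLinearGroup.det (GLn.ofInfinite n K (expGL X)) *
        Matrix.GeneralLinearGroup.det (GLn.ofInfinite n K (expGL Y)) := by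
  rw [← map_mul, ← map_mul]
  refine det_ofInfinite_eq_of_det_eq ?_
  rw [Units.val_mul, Matrix.det_mul, coe_expGL, coe_expGL, coe_expGL,
    Literature.Analysis.Matrix.det_exp_eq_exp_trace, Literature.Analysis.Matrix.det_exp_eq_exp_trace,
    Literature.Analysis.Matrix.det_exp_eq_exp_trace, Matrix.trace_add, NormedSpace.exp_add]

/-- `det (exp X, 1) = 1` in `𝕀_K` for `X ∈ 𝔤𝔩_n(K_∞)` of trace zero. [folklore] -/
theorem det_ofInfinite_expGL_eq_one_of_trace_eq_zero {X : Matrix (Fin n) (Fin n) (mixedSpace K)}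
    (hX : X.trace = 0) :
    Matrix.GeneralLinearGroup.det (GLn.ofInfinite n K (expGL X)) = 1 := by
  rw [← (Matrix.GeneralLinearGroup.det.comp (GLn.ofInfinite n K)).map_one]
  refine det_ofInfinite_eq_of_det_eq ?_
  rw [coe_expGL, Literature.Analysis.Matrix.det_exp_eq_exp_trace, hX, NormedSpace.exp_zero,
    Units.val_one, Matrix.det_one]

-- Mathlib idiom (Mathlib/Algebra/Lie/OfAssociative.lean): the commutator Lie ring on matrices
/-- **The archimedean differential of `χ ∘ det` on `GL_n`.** For every idèle class character `χ` of
`K` there is a real-linear `δ : 𝔤𝔩_n(K_∞) → ℂ` vanishing on brackets with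
`χ (det (exp X, 1)) = e^{δ(X)}` for all `X ∈ 𝔤`: `X ↦ χ(det(exp X, 1))` is a character of the additive
group `𝔤𝔩_n(K_∞)` (`det_ofInfinite_expGL_add`), continuous along lines and nowhere zero, hence the
exponential of a linear form (`exists_linearMap_exp_eq`), which kills brackets because
`det (exp t[X, Y], 1) = 1`. For `χ = ‖·‖^s` this is `exists_linearMap_detTwist_ofArch_expMem`, for
`n = 1` `exists_linearMap_detTwist_ofArch_expMem_glOne`. Tate (1950), §2.3 (quasi-characters of
`K_wˣ` near `1`); Borel–Jacquet 1979, 5.7. [cite: TateThesis1967, §2.3] -/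
theorem exists_linearMap_detTwist_ofArch_expMem_hecke (hcpt : isCompact_glFiniteIntegralLevel n K)
    (χ : HeckeCharacter K) :
    ∃ δ : (AutomorphyDatum.gl n K hcpt).arch.lie →ₗ[ℝ] ℂ,
      (∀ X Y : (AutomorphyDatum.gl n K hcpt).arch.lie, δ ⁅X, Y⁆ = 0) ∧
      ∀ X : (AutomorphyDatum.gl n K hcpt).arch.lie,
        ((detTwist n χ ((AutomorphyDatum.gl n K hcpt).ofArch
          ((AutomorphyDatum.gl n K hcpt).arch.expMem X)) : ℂˣ) : ℂ) = Complex.exp (δ X) := by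
  letI : LieRing (Matrix (Fin n) (Fin n) (mixedSpace K)) := LieRing.ofAssociativeRing
  set f : (AutomorphyDatum.gl n K hcpt).arch.lie → ℂ := fun X =>
    ((detTwist n χ ((AutomorphyDatum.gl n K hcpt).ofArch
      ((AutomorphyDatum.gl n K hcpt).arch.expMem X)) : ℂˣ) : ℂ) with hf
  have hfX : ∀ X : (AutomorphyDatum.gl n K hcpt).arch.lie, f X =
      ((χ (Matrix.GeneralLinearGroup.det (GLn.ofInfinite n K
        (expGL ((X : (AutomorphyDatum.gl n K hcpt).arch.lie) : Matrix (Fin n) (Fin n) (mixedSpace K))))) :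
          ℂˣ) : ℂ) := fun X => rfl
  have hmul : ∀ X Y, f (X + Y) = f X * f Y := fun X Y => by
    rw [hfX, hfX, hfX, ← Units.val_mul, ← map_mul, ← det_ofInfinite_expGL_add]
    rfl
  have hcont : ∀ X, Continuous fun t : ℝ => f (t • X) := fun X =>
    Units.continuous_val.comp ((continuous_detTwist n χ).comp
      ((AutomorphyDatum.gl n K hcpt).continuous_ofArch.comp (continuous_expMem_smul X)))
  obtain ⟨δ, hδ⟩ := exists_linearMap_exp_eq hcont (fun X => Units.ne_zero _) hmul
  refine ⟨δ, fun X Y => ?_, fun X => hδ X⟩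
  -- `f (t [X, Y]) = 1`, so `e^{t δ[X, Y]} = 1` for all real `t`
  have h1 : ∀ t : ℝ, f (t • ⁅X, Y⁆) = 1 := fun t => by
    rw [hfX, det_ofInfinite_expGL_eq_one_of_trace_eq_zero, map_one, Units.val_one]
    change (t • ((X : Matrix (Fin n) (Fin n) (mixedSpace K)) * (Y : Matrix (Fin n) (Fin n) (mixedSpace K)) -
      (Y : Matrix (Fin n) (Fin n) (mixedSpace K)) * (X : Matrix (Fin n) (Fin n) (mixedSpace K)))).trace = 0
    rw [Matrix.trace_smul, Matrix.trace_sub, Matrix.trace_mul_comm, sub_self, smul_zero]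
  refine eq_of_forall_exp_mul_eq (b := 0) fun t => ?_
  rw [zero_mul, Complex.exp_zero, mul_comm, ← Complex.real_smul, ← map_smul, ← hδ, h1]

/-! ### `(χ ∘ det) · φ` is an automorphic form, for every Hecke character `χ` -/

variable {hcpt : isCompact_glFiniteIntegralLevel n K}

/-- `GLn.ofFinite` is injective (`GLn.sndHom` is a retraction). [folklore] -/
theorem GLn.ofFinite_injective : Function.Injective (GLn.ofFinite n K) := fun a b h => by
  simpa only [GLn.sndHom_ofFinite] using congrArg (GLn.sndHom n K) h

/-- The intersection of two admissible levels of `GL_n` is an admissible level. [folklore] -/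
theorem inf_mem_finiteLevelsGL {U V : Subgroup (GL (Fin n) (AdeleRing (𝓞 K) K))}
    (hU : U ∈ finiteLevelsGL n K) (hV : V ∈ finiteLevelsGL n K) : U ⊓ V ∈ finiteLevelsGL n K := by
  obtain ⟨U₀, hUo, hUc, rfl⟩ := hU
  obtain ⟨V₀, hVo, hVc, rfl⟩ := hV
  refine ⟨U₀ ⊓ V₀, hUo.inter hVo, hUc.inter_right (V₀.isClosed_of_isOpen hVo), ?_⟩
  rw [Subgroup.map_inf U₀ V₀ _ GLn.ofFinite_injective]

/-- **`|χ ∘ det| = |det|_𝔸^σ`**: `‖χ (det g)‖ = |det g|_𝔸^σ` for the real exponent `σ` of `χ`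
(`HeckeCharacter.exists_norm_apply_eq_ideleNorm_rpow`). [folklore] -/
theorem exists_norm_detTwist_eq_ideleNorm_rpow (χ : HeckeCharacter K) :
    ∃ σ : ℝ, ∀ g : GL (Fin n) (AdeleRing (𝓞 K) K),
      ‖(detTwist n χ g : ℂ)‖ = GaloisRepresentations.ideleNorm (Matrix.GeneralLinearGroup.det g) ^ σ := by
  obtain ⟨σ, hσ⟩ := χ.exists_norm_apply_eq_ideleNorm_rpow
  exact ⟨σ, fun g => by rw [detTwist_apply, hσ]⟩

/-- **Twists of automorphic forms by `χ ∘ det` are automorphic forms, for every idèle class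
character `χ`** (`n ≥ 1`): conditions (a)–(d) of Borel–Jacquet 1979, §4.2 for `(χ ∘ det) · φ` —
left `GL_n(K)`-invariance (`det γ ∈ Kˣ`); the level `U ∩ K(𝔪)` for a level `U` of `φ` and a level
`𝔪` of `χ` (`HeckeCharacter.exists_level`); smoothness (`isArchSmooth_mulChar_of_exp`) and
`Z(𝔤)`-finiteness (`isZFinite_mulChar_of_exp`) from the differential of `χ ∘ det` along `𝔤`
(`exists_linearMap_detTwist_ofArch_expMem_hecke`); `K_∞`-finiteness (`isKFinite_mulChar`); moderate
growth from `|χ| = ‖·‖^σ` and `|det g|_𝔸^σ ≤ C (1 ⊔ ‖g‖)^r` (`exists_ideleNorm_det_rpow_le_height`).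
The cases `χ` of finite order and `χ = ‖·‖^s` are `IsAutomorphicForm.mulChar_detTwist` and
`IsAutomorphicForm.mulChar_detTwist_of_cpow`. Borel–Jacquet 1979, §4.2 and 5.7; Jacquet–Langlands
1970, §11 (`π ⊗ χ`). [cite: BorelJacquet1979, §4.2] -/
theorem IsAutomorphicForm.mulChar_detTwist_hecke [NeZero n] (χ : HeckeCharacter K)
    {φ : (AdelicGroupData.gl n K).Adelic → ℂ} (hφ : IsAutomorphicForm (AutomorphyDatum.gl n K hcpt) φ) :
    IsAutomorphicForm (AutomorphyDatum.gl n K hcpt) (mulChar (detTwist n χ) φ) := by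
  obtain ⟨δ, hδbr, hδ⟩ := exists_linearMap_detTwist_ofArch_expMem_hecke hcpt χ
  haveI : FiniteDimensional ℝ (mixedSpace K) := inferInstance
  refine ⟨?_, ?_, ?_, ?_, ?_, ?_⟩
  · intro γ hγ g
    rw [mulChar_apply, mulChar_apply, map_mul, detTwist_eq_one_of_mem_arithmeticSubgroup n χ hγ,
      one_mul, hφ.leftInvariant γ hγ g]
  · obtain ⟨U, hU, hUφ⟩ := hφ.exists_level
    obtain ⟨𝔪, h𝔪, hχ𝔪⟩ := χ.exists_level n
    refine ⟨U ⊓ principalCongruenceLevel n K 𝔪,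
      inf_mem_finiteLevelsGL hU (principalCongruenceLevel_mem_finiteLevelsGL_holds n K h𝔪),
      fun u hu g => ?_⟩
    have hu1 : detTwist n χ u = 1 := by rw [detTwist_apply']; exact hχ𝔪 u hu.2
    rw [mulChar_apply, mulChar_apply, map_mul, hUφ u hu.1 g, hu1, mul_one]
  · exact isArchSmooth_mulChar_of_exp _ hδ hφ.archSmooth
  · exact isKFinite_mulChar _ hφ.kFinite
  · exact isZFinite_mulChar_of_exp _ hδbr hδ hφ.archSmooth hφ.zFinite
  · obtain ⟨C, r, hC⟩ := hφ.moderateGrowth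
    obtain ⟨σ, hσ⟩ := exists_norm_detTwist_eq_ideleNorm_rpow (n := n) χ
    obtain ⟨C', r', -, hC'⟩ := exists_ideleNorm_det_rpow_le_height (n := n) (K := K) σ
    refine ⟨C' * C, r' + r, fun g => ?_⟩
    have h1 := hC' g
    have h2 := hC g
    rw [AutomorphyDatum.gl_height] at h2 ⊢
    have hN : 0 ≤ GaloisRepresentations.ideleNorm (Matrix.GeneralLinearGroup.det g) := by
      rw [← coe_ideleNorm]; exact NNReal.coe_nonneg _
    rw [mulChar_apply, norm_mul, hσ, pow_add, mul_mul_mul_comm]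
    exact mul_le_mul h1 h2 (norm_nonneg _) ((Real.rpow_nonneg hN _).trans h1)

/-- The twist `W · (χ ∘ det)` of a space `W` of automorphic forms consists of automorphic forms
(`n ≥ 1`, `χ` any Hecke character). Borel–Jacquet 1979, §4.2–4.3. [cite: BorelJacquet1979, §4.3] -/
theorem map_mulChar_detTwist_le_automorphicForms_hecke [NeZero n] (χ : HeckeCharacter K)
    {W : Submodule ℂ ((AdelicGroupData.gl n K).Adelic → ℂ)}
    (hW : W ≤ automorphicForms (AutomorphyDatum.gl n K hcpt)) :
    W.map (mulChar (detTwist n χ)) ≤ automorphicForms (AutomorphyDatum.gl n K hcpt) := by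
  refine (Submodule.map_mono hW).trans ?_
  rw [automorphicForms, Submodule.map_span, Submodule.span_le]
  rintro _ ⟨φ, hφ, rfl⟩
  exact Submodule.subset_span (IsAutomorphicForm.mulChar_detTwist_hecke χ hφ)

/-- **Twists of stable subspaces by `χ ∘ det` are stable** (`(𝔤, K_∞) × GL_n(𝔸_K^∞)`-submodules
of `𝒜`; `n ≥ 1`, `χ` any Hecke character): `r(h) (c · φ) = c(h) · (c · r(h) φ)` and
`X (c · φ) = c · (X φ + δ(X) φ)` (`lieDeriv_mulChar_of_exp`). Borel–Jacquet 1979, §4.3, §4.6 and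
5.7. [cite: BorelJacquet1979, §4.6] -/
theorem IsStableSubmodule.map_mulChar_detTwist_hecke [NeZero n] (χ : HeckeCharacter K)
    {W : Submodule ℂ ((AdelicGroupData.gl n K).Adelic → ℂ)}
    (hW : IsStableSubmodule (AutomorphyDatum.gl n K hcpt) W) :
    IsStableSubmodule (AutomorphyDatum.gl n K hcpt) (W.map (mulChar (detTwist n χ))) where
  le_automorphicForms := map_mulChar_detTwist_le_automorphicForms_hecke χ hW.le_automorphicForms
  finite_stable h hh := by
    rintro _ ⟨φ, hφ, rfl⟩
    rw [Submodule.mem_comap, rightTranslation_mulChar]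
    exact Submodule.smul_mem _ _ (Submodule.mem_map_of_mem (hW.finite_stable h hh hφ))
  k_stable k := by
    rintro _ ⟨φ, hφ, rfl⟩
    rw [Submodule.mem_comap, rightTranslation_mulChar]
    exact Submodule.smul_mem _ _ (Submodule.mem_map_of_mem (hW.k_stable k hφ))
  lie_stable X := by
    rintro _ ⟨φ, hφ, rfl⟩
    obtain ⟨δ, -, hδ⟩ := exists_linearMap_detTwist_ofArch_expMem_hecke hcpt χ
    haveI : FiniteDimensional ℝ (mixedSpace K) := inferInstance
    rw [lieDeriv_mulChar_of_exp _ hδ X (hW.isArchSmooth hφ), map_add, map_smul]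
    exact Submodule.add_mem _ (Submodule.mem_map_of_mem (hW.lie_stable X φ hφ))
      (Submodule.smul_mem _ _ (Submodule.mem_map_of_mem hφ))

/-- **The twist `π ⊗ (χ ∘ det)` of an automorphic representation of `GL_n(𝔸_K)` in the sense of
Borel–Jacquet, by an arbitrary idèle class character `χ`** (`n ≥ 1`): there is a datum
`π' = W · c / W' · c`, `c = χ ∘ det` (irreducibility transported along `W'' ↦ W'' · c⁻¹`,
`c⁻¹ = χ⁻¹ ∘ det`). Packaged existentially (no definition; for `χ` of finite order this datum is
`AutomorphicRepData.twist π χ`, for `χ = ‖·‖^s` it is `exists_automorphicRepData_map_mulChar_detTwist`).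
Borel–Jacquet 1979, §4.6 and 5.7; Jacquet–Langlands 1970, §11; Arthur–Clozel 1989, Ch. 3 §1
(`π ⊗ χ`). [cite: BorelJacquet1979, §4.6] -/
theorem exists_automorphicRepData_twist_hecke [NeZero n] (χ : HeckeCharacter K)
    (π : AutomorphicRepData (AutomorphyDatum.gl n K hcpt)) :
    ∃ π' : AutomorphicRepData (AutomorphyDatum.gl n K hcpt),
      π'.W = π.W.map (mulChar (detTwist n χ)) ∧ π'.W' = π.W'.map (mulChar (detTwist n χ)) := by
  refine ⟨{ W := π.W.map (mulChar (detTwist n χ))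
            W' := π.W'.map (mulChar (detTwist n χ))
            lt := Submodule.map_strictMono_of_injective (mulChar_injective _) π.lt
            stable := π.stable.map_mulChar_detTwist_hecke χ
            stable' := π.stable'.map_mulChar_detTwist_hecke χ
            irreducible := fun W'' h₁ h₂ hst => ?_ }, rfl, rfl⟩
  have hst' := hst.map_mulChar_detTwist_hecke χ⁻¹
  rw [detTwist_inv] at hst'
  have h₁' : π.W' ≤ W''.map (mulChar (detTwist n χ)⁻¹) := by
    rw [← map_mulChar_inv_map_mulChar (detTwist n χ) π.W']
    exact Submodule.map_mono h₁
  have h₂' : W''.map (mulChar (detTwist n χ)⁻¹) ≤ π.W := by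
    rw [← map_mulChar_inv_map_mulChar (detTwist n χ) π.W]
    exact Submodule.map_mono h₂
  rcases π.irreducible _ h₁' h₂' hst' with h | h
  · left
    rw [← map_mulChar_map_mulChar_inv (detTwist n χ) W'', h]
  · right
    rw [← map_mulChar_map_mulChar_inv (detTwist n χ) W'', h]

/-- **Twists of cusp forms by `χ ∘ det` are cusp forms** (`χ ∘ det` is trivial on the unipotent
radicals, `CuspConditionGL.mulChar_detTwist`). Borel–Jacquet 1979, 4.4. [cite: BorelJacquet1979, 4.4] -/
theorem IsCuspFormGL.mulChar_detTwist_hecke [NeZero n] (χ : HeckeCharacter K)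
    {φ : (AdelicGroupData.gl n K).Adelic → ℂ} (hφ : IsCuspFormGL n K hcpt φ) :
    IsCuspFormGL n K hcpt (mulChar (detTwist n χ) φ) :=
  ⟨hφ.1.mulChar_detTwist_hecke χ, fun k hk hkn => (hφ.2 k hk hkn).mulChar_detTwist χ⟩

/-- The twist by `χ ∘ det` of a space of cusp forms consists of cusp forms. Borel–Jacquet 1979,
4.4–4.6. [cite: BorelJacquet1979, 4.6] -/
theorem map_mulChar_detTwist_le_cuspFormsGL_hecke [NeZero n] (χ : HeckeCharacter K)
    {W : Submodule ℂ ((AdelicGroupData.gl n K).Adelic → ℂ)} (hW : W ≤ cuspFormsGL n K hcpt) :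
    W.map (mulChar (detTwist n χ)) ≤ cuspFormsGL n K hcpt := by
  refine (Submodule.map_mono hW).trans ?_
  rw [cuspFormsGL, Submodule.map_span, Submodule.span_le]
  rintro _ ⟨φ, hφ, rfl⟩
  exact Submodule.subset_span (IsCuspFormGL.mulChar_detTwist_hecke χ hφ)

/-- **The twist `π ⊗ (χ ∘ det)` of a cuspidal automorphic representation of `GL_n(𝔸_K)` by an
arbitrary idèle class character `χ` is a cuspidal automorphic representation** (Borel–Jacquet
datum, `n ≥ 1`; packaged existentially). Borel–Jacquet 1979, 4.6 and 5.7; Jacquet–Langlands 1970,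
§11. [cite: BorelJacquet1979, 5.7] -/
theorem exists_cuspidalAutomorphicRepData_twist_hecke [NeZero n] (χ : HeckeCharacter K)
    (π : CuspidalAutomorphicRepData n K hcpt) :
    ∃ π' : CuspidalAutomorphicRepData n K hcpt,
      π'.1.W = π.1.W.map (mulChar (detTwist n χ)) ∧ π'.1.W' = π.1.W'.map (mulChar (detTwist n χ)) := by
  obtain ⟨π', hW, hW'⟩ := exists_automorphicRepData_twist_hecke χ π.1
  exact ⟨⟨π', hW ▸ map_mulChar_detTwist_le_cuspFormsGL_hecke χ π.2⟩, hW, hW'⟩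

/-! ### Satake parameters of the twist: `t_{π ⊗ χ, v} = χ(ϖ_v) t_{π, v}` -/

/-- **Satake parameters of `π ⊗ (χ ∘ det)` for an arbitrary Hecke character `χ`** (Arthur–Clozel
1989, Ch. 3, proof of Thm. 3.1, p. 172: `t_{π ⊗ η, v} = η(ϖ_v) t_{π, v}`; Jacquet–Langlands 1970,
§11). If `π` has Satake parameter `α` at `v`, `χ ∘ det` is trivial on `K(𝔪)` with `v ∤ 𝔪`, and
`π'` is the twisted datum (`W' · c ≤ W · c`, `c = χ ∘ det`), then `π'` has Satake parameter
`χ_v(ϖ) · α` at `v` (level `K(𝔫𝔪)`, eigenform `c · φ`): verbatim the computation of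
`AutomorphicRepData.HasSatakeParamAt.twist` (change of level on `K(𝔫)`-fixed forms,
`[K t_{v,i} K] (c φ) = c(t_{v,i}) c [K t_{v,i} K] φ`, `det t_{v,i} = ϖ^i`, `e_i(z α) = z^i e_i(α)`),
which needs no finiteness of the order of `χ`. [cite: ArthurClozelAMS120, Ch. 3, proof of Thm. 3.1 (p. 172)] -/
theorem AutomorphicRepData.HasSatakeParamAt.map_mulChar_detTwist_hecke
    {π π' : AutomorphicRepData (AutomorphyDatum.gl n K hcpt)}
    {v : HeightOneSpectrum (𝓞 K)} {α : Multiset ℂ} (h : π.HasSatakeParamAt v α)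
    (χ : HeckeCharacter K) {𝔪 : Ideal (𝓞 K)} (h𝔪 : 𝔪 ≠ 0)
    (hχ𝔪 : ∀ k ∈ principalCongruenceLevel n K 𝔪, χ (Matrix.GeneralLinearGroup.det k) = 1)
    (hv : ¬ v.asIdeal ∣ 𝔪) (hW : π'.W = π.W.map (mulChar (detTwist n χ)))
    (hW' : π'.W' = π.W'.map (mulChar (detTwist n χ))) :
    ∃ ϖ : (v.adicCompletion K)ˣ, Valued.v (ϖ : v.adicCompletion K) = WithZero.exp (-1 : ℤ) ∧
      π'.HasSatakeParamAt v (α.map (((χ (localUnits v ϖ) : ℂˣ) : ℂ) * ·)) := by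
  obtain ⟨𝔫, ϖ, h𝔫, hv𝔫, hϖ, hcard, φ, hφW, hφW', hfix, hT⟩ := h
  set c := detTwist n χ with hc
  set z : ℂ := ((χ (localUnits v ϖ) : ℂˣ) : ℂ) with hz
  have h𝔫𝔪 : 𝔫 * 𝔪 ≠ 0 := mul_ne_zero h𝔫 h𝔪
  have hv' : ¬ v.asIdeal ∣ 𝔫 * 𝔪 := by
    intro hdvd
    rcases (Ideal.IsPrime.mul_le v.isPrime).mp (Ideal.le_of_dvd hdvd) with h | h
    · exact hv𝔫 (Ideal.dvd_iff_le.mpr h)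
    · exact hv (Ideal.dvd_iff_le.mpr h)
  have hle𝔫 : principalCongruenceLevel n K (𝔫 * 𝔪) ≤ principalCongruenceLevel n K 𝔫 :=
    principalCongruenceLevel_mono n K h𝔫𝔪 Ideal.mul_le_right
  have hle𝔪 : principalCongruenceLevel n K (𝔫 * 𝔪) ≤ principalCongruenceLevel n K 𝔪 :=
    principalCongruenceLevel_mono n K h𝔫𝔪 Ideal.mul_le_left
  have hcU : ∀ u ∈ principalCongruenceLevel n K (𝔫 * 𝔪), c u = 1 := fun u hu => hχ𝔪 u (hle𝔪 hu)
  -- `φ` is fixed by `K(𝔫)` and `K(𝔫𝔪)`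
  have hφfix : φ ∈ (rightTranslation (AdelicGroupData.gl n K)).fixedPoints
      (principalCongruenceLevel n K 𝔫) :=
    (isRightInvariantUnder_iff_mem_fixedPoints _ _ _).mp fun u hu g => congrFun (hfix u hu) g
  have hφfix' : φ ∈ (rightTranslation (AdelicGroupData.gl n K)).fixedPoints
      (principalCongruenceLevel n K (𝔫 * 𝔪)) :=
    (isRightInvariantUnder_iff_mem_fixedPoints _ _ _).mp fun u hu g => congrFun (hfix u (hle𝔫 hu)) g
  refine ⟨ϖ, hϖ, 𝔫 * 𝔪, ϖ, h𝔫𝔪, hv', hϖ, by rw [Multiset.card_map, hcard], mulChar c φ,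
    hW ▸ Submodule.mem_map_of_mem hφW,
    fun hmem => hφW' ((mulChar_mem_map_mulChar_iff _ _ _).mp (hW' ▸ hmem)),
    fun u hu => ?_, fun i hi => ?_⟩
  · rw [rightTranslation_mulChar, hfix u (hle𝔫 hu), hcU u hu, Units.val_one, one_smul]
  · -- change of level for `φ`
    have hlev : heckeOperator (rightTranslation (AdelicGroupData.gl n K))
        (principalCongruenceLevel n K (𝔫 * 𝔪)) (heckeDiagAt n K v ϖ i) φ =
        heckeOperator (rightTranslation (AdelicGroupData.gl n K))
          (principalCongruenceLevel n K 𝔫) (heckeDiagAt n K v ϖ i) φ := by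
      rw [heckeDiagAt_eq_ofLocal_glDiagonal]
      exact (heckeOperator_sphericalLevelAt_eq_principalCongruenceLevel
          (rightTranslation (AdelicGroupData.gl n K)) h𝔫𝔪 hv' _ hφfix').symm.trans
        (heckeOperator_sphericalLevelAt_eq_principalCongruenceLevel
          (rightTranslation (AdelicGroupData.gl n K)) h𝔫 hv𝔫 _ hφfix)
    -- the twisted Hecke operator
    have htw : heckeOperator (rightTranslation (AdelicGroupData.gl n K))
        (principalCongruenceLevel n K (𝔫 * 𝔪)) (heckeDiagAt n K v ϖ i) (mulChar c φ) =
        (c (heckeDiagAt n K v ϖ i) : ℂ) • mulChar c (heckeOperator (rightTranslation (AdelicGroupData.gl n K))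
          (principalCongruenceLevel n K (𝔫 * 𝔪)) (heckeDiagAt n K v ϖ i) φ) :=
      heckeOperator_apply_semilinear _ _ (mulChar c) (fun x => (c x : ℂ))
        (fun x ψ => rightTranslation_mulChar _ c x ψ) _
        (fun y hy => by rw [apply_out_eq_of_mem_orbit c _ hcU _ hy]) φ
    have hct : (c (heckeDiagAt n K v ϖ i) : ℂ) = z ^ i := by
      rw [hc, detTwist_apply, det_heckeDiagAt v ϖ hi, map_pow, Units.val_pow_eq_pow_val]
    rw [hW', htw, hlev, hct, esymm_map_const_mul]
    have key : z ^ i • mulChar c (heckeOperator (rightTranslation (AdelicGroupData.gl n K))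
          (principalCongruenceLevel n K 𝔫) (heckeDiagAt n K v ϖ i) φ) -
        ((((Real.sqrt (v.residueCard : ℝ)) : ℝ) : ℂ) ^ (i * (n - i)) * (z ^ i * α.esymm i)) •
          mulChar c φ =
        mulChar c (z ^ i • (heckeOperator (rightTranslation (AdelicGroupData.gl n K))
          (principalCongruenceLevel n K 𝔫) (heckeDiagAt n K v ϖ i) φ -
            ((((Real.sqrt (v.residueCard : ℝ)) : ℝ) : ℂ) ^ (i * (n - i)) * α.esymm i) • φ)) := by
      rw [map_smul, map_sub, map_smul, smul_sub, smul_smul, mul_left_comm]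
    rw [key]
    exact Submodule.mem_map_of_mem (Submodule.smul_mem _ _ (hT i hi))

/-- **Satake parameters of `π ⊗ (χ ∘ det)` at an unramified place of `χ`**: with `χ` unramified
at `v ∤ 𝔪`, the Satake parameter of the twist at `v` is `χ(ϖ_v) · α`
(`HeckeCharacter.valueAtUniformizer`). Arthur–Clozel 1989, Ch. 3, proof of Thm. 3.1 (p. 172). [cite: ArthurClozelAMS120, Ch. 3, proof of Thm. 3.1 (p. 172)] -/
theorem AutomorphicRepData.HasSatakeParamAt.map_mulChar_detTwist_hecke_of_isUnramifiedAt
    {π π' : AutomorphicRepData (AutomorphyDatum.gl n K hcpt)}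
    {v : HeightOneSpectrum (𝓞 K)} {α : Multiset ℂ} (h : π.HasSatakeParamAt v α)
    (χ : HeckeCharacter K) {𝔪 : Ideal (𝓞 K)} (h𝔪 : 𝔪 ≠ 0)
    (hχ𝔪 : ∀ k ∈ principalCongruenceLevel n K 𝔪, χ (Matrix.GeneralLinearGroup.det k) = 1)
    (hv : ¬ v.asIdeal ∣ 𝔪) (hvu : χ.IsUnramifiedAt v) (hW : π'.W = π.W.map (mulChar (detTwist n χ)))
    (hW' : π'.W' = π.W'.map (mulChar (detTwist n χ))) :
    π'.HasSatakeParamAt v (α.map (χ.valueAtUniformizer v * ·)) := by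
  obtain ⟨ϖ, hϖ, hS⟩ := h.map_mulChar_detTwist_hecke χ h𝔪 hχ𝔪 hv hW hW'
  rwa [← GaloisRepresentations.HeckeCharacter.localComponent_apply,
    GaloisRepresentations.HeckeCharacter.localComponent_eq_valueAtUniformizer hvu hϖ] at hS

/-- **Almost everywhere form**, for an arbitrary idèle class character `χ`: outside the primes of
a level `𝔪` of `χ ∘ det` (`HeckeCharacter.exists_level`) and the finitely many ramified places of
`χ` (`HeckeCharacter.finite_ramifiedPlaces_holds`), every Satake parameter `α` of `π` at `v` gives
the Satake parameter `χ(ϖ_v) · α` of the twisted datum `π'` (`W' · c ≤ W · c`, `c = χ ∘ det`) at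
`v`. Arthur–Clozel 1989, Ch. 3, proof of Thm. 3.1 (p. 172). [cite: ArthurClozelAMS120, Ch. 3, proof of Thm. 3.1 (p. 172)] -/
theorem AutomorphicRepData.eventually_hasSatakeParamAt_of_map_mulChar_detTwist
    {π π' : AutomorphicRepData (AutomorphyDatum.gl n K hcpt)} (χ : HeckeCharacter K)
    (hW : π'.W = π.W.map (mulChar (detTwist n χ))) (hW' : π'.W' = π.W'.map (mulChar (detTwist n χ))) :
    ∀ᶠ v : HeightOneSpectrum (𝓞 K) in Filter.cofinite, ∀ α : Multiset ℂ,
      π.HasSatakeParamAt v α → π'.HasSatakeParamAt v (α.map (χ.valueAtUniformizer v * ·)) := by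
  obtain ⟨𝔪, h𝔪, hχ𝔪⟩ := χ.exists_level n
  have h1 : ∀ᶠ v : HeightOneSpectrum (𝓞 K) in Filter.cofinite, ¬ v.asIdeal ∣ 𝔪 := by
    rw [Filter.eventually_cofinite]
    simpa only [not_not] using Ideal.finite_factors h𝔪
  have h2 : ∀ᶠ v : HeightOneSpectrum (𝓞 K) in Filter.cofinite, χ.IsUnramifiedAt v :=
    (GaloisRepresentations.HeckeCharacter.finite_ramifiedPlaces_iff χ).mp χ.finite_ramifiedPlaces_holds
  filter_upwards [h1, h2] with v hv hvu α hα
  exact hα.map_mulChar_detTwist_hecke_of_isUnramifiedAt χ h𝔪 hχ𝔪 hv hvu hW hW'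

/-- **The twist `π ⊗ (χ ∘ det)` of a cuspidal `π` on `GL_n(𝔸_K)` and its Satake parameters, in one
statement**: for every idèle class character `χ` and cuspidal Borel–Jacquet datum `π` (`n ≥ 1`)
there is a cuspidal datum `π'` with `t_{π', v} = χ(ϖ_v) · t_{π, v}` for almost all `v`.
Borel–Jacquet 1979, 5.7; Arthur–Clozel 1989, Ch. 3, proof of Thm. 3.1 (p. 172). [cite: ArthurClozelAMS120, Ch. 3, proof of Thm. 3.1 (p. 172)] -/
theorem CuspidalAutomorphicRepData.exists_twist_hecke_hasSatakeParamAt [NeZero n] (χ : HeckeCharacter K)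
    (π : CuspidalAutomorphicRepData n K hcpt) :
    ∃ π' : CuspidalAutomorphicRepData n K hcpt,
      ∀ᶠ v : HeightOneSpectrum (𝓞 K) in Filter.cofinite, ∀ α : Multiset ℂ,
        π.1.HasSatakeParamAt v α → π'.1.HasSatakeParamAt v (α.map (χ.valueAtUniformizer v * ·)) := by
  obtain ⟨π', hW, hW'⟩ := exists_cuspidalAutomorphicRepData_twist_hecke χ π
  exact ⟨π', AutomorphicRepData.eventually_hasSatakeParamAt_of_map_mulChar_detTwist χ hW hW'⟩

end DetTwistHecke

end Literature.NumberTheory.Automorphic
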